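import Summits.QuantumFields.YangMills.Theorems.InfiniteVolumeMomentBounds
import Summits.QuantumFields.YangMills.Theorems.LangevinControlUVOSLegsFromFemtoAndGapStubAssemblyShiftedBound
import Summits.QuantumFields.YangMills.Theorems.LangevinControlUVOSLegsFromFemtoAndGapStubAssemblyLimit
import HarnessLib

/-!
# Infinite volume by compactness, step 2: the a-uniform E0′ bound for the plane-string moments of an
# infinite-volume state, absolutely and on all of `(ℤ⁴)ⁿ`

HONEST FRAMING (cell `ym-fleet`, seat `ym-infvol-p2`, director-ym R136 (i) «INFINITE-VOLUME ∕ CONTINUUM-FROM-UV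
ROUTE», pre-birth helper; bears on LADDER-YM R1∕R2a).  Pure soft analysis, kernel-checked; NOTHING here is a
statement about Bałaban's renormalisation group, the continuum limit, uniqueness of the infinite-volume state, a mass
gap, or Clay.  The only Yang–Mills-specific input type is the spine's UV-leg currency `MomentBounds6 G r a`,
consumed as a HYPOTHESIS (§4); §§1–3 are abstract.

WHY.  An «`L → ∞` first, then `a → 0`» extraction of continuum Schwinger functions reads, in an infinite-volume
lattice state `μ` on `LGConfig 4 G`, the lattice functionals `F ↦ Σ_{x ∈ T} W_μ(q, x) · F(y(x))` of plane strings
(`W_μ(q, x) = ∫ ∏ᵢ (plane qᵢ xᵢ − ∫ plane qᵢ xᵢ dμ) dμ`, evaluation points `y(x)` within `s·a` of `a·x`, `T` a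
finite set of multi-sites — a box of any size, or all of `(ℤ⁴)ⁿ` as a series).  Step 1
(`momentBounds6_oddTorusLimitPoints`) put the collar bound `(C/R⁴)ⁿ` at `ℤ⁴`-separated sites on these weights for
odd-torus limit states; this file turns it into the a-UNIFORM Schwartz bound on `⁰𝒮ₙ` (the E0′ input of the
compactness step `exists_subseq_clm_limit` and of the E2 ∕ E1 density steps) with ONE constant for all finite `T`,
hence absolute summability on `(ℤ⁴)ⁿ`.  The analysis is the spine toolkit X-b BY NAME
(`OSLegsFromFemtoAndGap.sum_abs_weight_mul_norm_le`: abstract weights, sup bound `Mⁿ`, TORUS-phrased collar bound on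
`(box 4 L)ⁿ`); new here: a `ℤ⁴`-phrased collar bound implies the torus-phrased one on every summation box with
`4R+8 ≤ L` (torus separation ⇒ `ℤ⁴` separation, §1), and an absolute bound uniform over boxes bounds every finite
sub-sum and the series.

WHAT IS PROVED ([folklore] throughout).  §1 `le_abs_of_le_abs_valMinAbs`, `torusCollar_of_zdCollar` (torus
separation mod `2L+1` with `4R+8 ≤ L` ⇒ `ℤ⁴` separation; a `ℤ⁴`-collar weight meets toolkit X-b's hypothesis on every
box).  §2 ABSTRACT WEIGHTS (sup bound `Mⁿ`, `ℤ⁴`-collar bound `(C/R⁴)ⁿ` for `1 ≤ R`, `R·a ≤ ℓ₄`; `0 < a ≤ 1`, `a ≤ ℓ₄`,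
`n ≥ 2`, shifts `s ≤ 6`, `s·a ≤ 1/4`, `F ∈ ⁰𝒮ₙ`): `subset_piFinset_box`, **`sum_abs_weight_mul_norm_le_of_zdCollar`**
(`Σ_{x ∈ T} |W x|·‖F(y x)‖ ≤ Kⁿ·Σ(F)` for EVERY finite `T`, `K` = toolkit X-b's constant), `summable_abs_weight_mul_norm`,
`tsum_abs_weight_mul_norm_le`, `summable_weight_mul`, **`norm_tsum_weight_mul_le`** (`≤ 5Kⁿ·schwartzNorm (10n) F`).
§3 WEIGHTS OF A STATE: `abs_infVolWeight_le` (sup bound `(Cₚ+Cₚ)ⁿ`), **`sum_abs_infVolWeight_mul_norm_le`**,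
`norm_tsum_infVolWeight_mul_le` (any probability measure whose plane-string weights obey the `ℤ⁴`-collar bound).
§4 **`exists_uniformBound_oddTorusLimitPoints`** ∕ `exists_tsumBound_oddTorusLimitPoints` — from `MomentBounds6 G r a`:
ONE `K` for every `β ≥ β₄` with `0 < a β ≤ min (1/24) ℓ₄`, EVERY `μ ∈ oddTorusLimitPoints r β`, every `n ≥ 2`, valid
`q`, `F ∈ ⁰𝒮ₙ`, shifts `≤ 6aβ`, EVERY finite `T ⊆ (ℤ⁴)ⁿ` (and the series) — the infinite-volume twin of the spine's
`norm_latticeSumStr_plane_le`, with NO torus-size side condition.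

References: Glimm–Jaffe (1987) §6.1; Osterwalder–Schrader CMP 42 (1975) §2; Chatterjee arXiv:1803.01950 §§2, 5.
-/

set_option autoImplicit false

noncomputable section

open scoped BigOperators SchwartzMap
open MeasureTheory Filter Topology
open Literature.MathematicalPhysics.QuantumFieldTheory hiding ZdEdge
open Literature.MathematicalPhysics.QuantumLattice
open Literature.MathematicalPhysics.AQFT
open Literature.Probability.LatticeModels (box Site mem_box)
open Summit.QuantumFields.YangMills.Cruxes.OSLegsFromFemtoAndGap.DlrCollarTransfer
  (plane MomentBounds6 exists_abs_plane_le)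
open Summit.QuantumFields.YangMills.Theorems.OSLegsFromFemtoAndGap
  (valMinAbs_intCast_of_abs_le sum_abs_weight_mul_norm_le seminorm_budget_le_schwartzNorm)

namespace Summit.QuantumFields.YangMills.Theorems.InfiniteVolume

/-! ## §1 Torus separation implies `ℤ⁴` separation (given `4R+8 ≤ L`) -/

section Separation

/-- If the torus representative of `d` mod `2L+1` has absolute value `≥ 2R+4` and `4R+8 ≤ L`, then `|d| ≥ 2R+4`
(either `|d| ≤ L` and the representative IS `d`, or `|d| > L ≥ 2R+4`). [folklore] -/
theorem le_abs_of_le_abs_valMinAbs {L R : ℕ} {d : ℤ} (hRL : 4 * R + 8 ≤ L)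
    (h : (2 * (R : ℤ) + 4) ≤ |((((d : ℤ) : ZMod (2 * L + 1))).valMinAbs : ℤ)|) : (2 * (R : ℤ) + 4) ≤ |d| := by
  by_cases hd : |d| ≤ (L : ℤ)
  · rwa [valMinAbs_intCast_of_abs_le hd] at h
  · push Not at hd
    have hRL' : (4 * (R : ℤ) + 8) ≤ (L : ℤ) := by exact_mod_cast hRL
    linarith

/-- **A `ℤ⁴`-collar weight satisfies the torus-phrased collar hypothesis of toolkit X-b on every box.**  If
`|W x| ≤ (C/R⁴)ⁿ` whenever the sites are pairwise `2R+4`-separated in some coordinate of `ℤ⁴` (`1 ≤ R`,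
`R·a ≤ ℓ₄`), then for every `L` the same holds under torus separation mod `2L+1` with `4R+8 ≤ L`. [folklore] -/
theorem torusCollar_of_zdCollar {n : ℕ} {W : (Fin n → Site 4) → ℝ} {C ℓ₄ a : ℝ}
    (H : ∀ (x : Fin n → Site 4) (R : ℕ), 1 ≤ R → (R : ℝ) * a ≤ ℓ₄ →
      (∀ i j : Fin n, i ≠ j → ∃ k : Fin 4, (2 * (R : ℤ) + 4) ≤ |x i k - x j k|) →
      |W x| ≤ (C / (R : ℝ) ^ 4) ^ n)
    (L : ℕ) :
    ∀ (x : Fin n → Site 4) (R : ℕ), 1 ≤ R → (R : ℝ) * a ≤ ℓ₄ → 4 * R + 8 ≤ L →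
      (∀ i j : Fin n, i ≠ j → ∃ k : Fin 4,
        (2 * (R : ℤ) + 4) ≤ |((((x i k - x j k : ℤ) : ZMod (2 * L + 1))).valMinAbs : ℤ)|) →
      |W x| ≤ (C / (R : ℝ) ^ 4) ^ n := by
  intro x R hR hRa hRL hsep
  refine H x R hR hRa fun i j hij => ?_
  obtain ⟨k, hk⟩ := hsep i j hij
  exact ⟨k, le_abs_of_le_abs_valMinAbs hRL hk⟩

end Separation

/-! ## §2 Abstract weights: the a-uniform absolute bound on every finite set and on the series -/

section Abstract

/-- Every finite set of multi-sites lies in some box `(box 4 L)ⁿ`, `L` above any threshold. [folklore] -/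
theorem subset_piFinset_box {n : ℕ} (T : Finset (Fin n → Site 4)) (L₀ : ℕ) :
    ∃ L : ℕ, L₀ ≤ L ∧ T ⊆ Fintype.piFinset (fun _ : Fin n => box 4 L) := by
  classical
  set M : ℕ := T.sup fun x => Finset.univ.sup fun i => Finset.univ.sup fun m => (x i m).natAbs with hM
  refine ⟨max L₀ M, le_max_left _ _, fun x hx => ?_⟩
  rw [Fintype.mem_piFinset]
  intro i
  rw [mem_box]
  intro m
  have h1 : (x i m).natAbs ≤ M := by
    rw [hM]
    exact le_trans (le_trans (Finset.le_sup (f := fun m => (x i m).natAbs) (Finset.mem_univ m))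
      (Finset.le_sup (f := fun i => Finset.univ.sup fun m => (x i m).natAbs) (Finset.mem_univ i)))
      (Finset.le_sup (f := fun x => Finset.univ.sup fun i => Finset.univ.sup fun m => (x i m).natAbs) hx)
  have h2 : (M : ℤ) ≤ ((max L₀ M : ℕ) : ℤ) := by exact_mod_cast le_max_right _ _
  have h3 : ((x i m).natAbs : ℤ) ≤ M := by exact_mod_cast h1
  constructor <;> omega

variable {n : ℕ}

/-- **The a-uniform ABSOLUTE bound for `ℤ⁴`-collar weights on every finite set of multi-sites.**  `W` any weight
with sup bound `Mⁿ` and `ℤ⁴`-collar bound `(C/R⁴)ⁿ` (`1 ≤ R`, `R·a ≤ ℓ₄`); `0 < a ≤ 1`, `a ≤ ℓ₄`, `n ≥ 2`,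
`0 ≤ s ≤ 6`, `s·a ≤ 1/4`; `F ∈ ⁰𝒮ₙ`; evaluation points `‖(y x)_l − a·x_l‖ ≤ s·a`.  Then for EVERY finite `T`:
`Σ_{x ∈ T} |W x|·‖F (y x)‖ ≤ Kⁿ·(S₀,₄ₙ + S₆ₙ,₄ₙ + S₀,₀ + S₆ₙ,₀ + S₁₀ₙ,₀)(F)` with toolkit X-b's
`K = (M 4⁴5⁶ + M 2⁶(10+2s)⁴ + 16C 2⁶(2/ℓ₄+48)⁴)·2⁶·81 Σ (m+1)⁻²` (enclose `T` in a box of half-side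
`≥ max 14 a⁻²` and apply `sum_abs_weight_mul_norm_le` through `torusCollar_of_zdCollar`). [folklore] -/
theorem sum_abs_weight_mul_norm_le_of_zdCollar {C ℓ₄ M a s : ℝ} (hℓ : 0 < ℓ₄) (hC : 0 ≤ C) (hM : 0 ≤ M)
    (W : (Fin n → Site 4) → ℝ) (hWsup : ∀ x, |W x| ≤ M ^ n)
    (H : ∀ (x : Fin n → Site 4) (R : ℕ), 1 ≤ R → (R : ℝ) * a ≤ ℓ₄ →
      (∀ i j : Fin n, i ≠ j → ∃ k : Fin 4, (2 * (R : ℤ) + 4) ≤ |x i k - x j k|) →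
      |W x| ≤ (C / (R : ℝ) ^ 4) ^ n)
    (ha : 0 < a) (ha1 : a ≤ 1) (haℓ : a ≤ ℓ₄) (hn : 2 ≤ n) (hs : 0 ≤ s) (hs6 : s ≤ 6) (hsa : s * a ≤ 1 / 4)
    (F : 𝓢((Fin n → EuclideanSpace ℝ (Fin 4)), ℂ)) (hF : IsOffDiagonal F)
    (y : (Fin n → Site 4) → (Fin n → EuclideanSpace ℝ (Fin 4)))
    (hyx : ∀ x l, ‖y x l - a • siteToE (x l)‖ ≤ s * a) (T : Finset (Fin n → Site 4)) :
    ∑ x ∈ T, |W x| * ‖F (y x)‖ ≤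
      ((M * 4 ^ 4 * 5 ^ 6 + M * 2 ^ 6 * (10 + 2 * s) ^ 4 + 16 * C * 2 ^ 6 * (2 / ℓ₄ + 48) ^ 4) * 2 ^ 6 *
          (81 * ∑' m : ℕ, (((m : ℝ) + 1) ^ 2)⁻¹)) ^ n *
        (SchwartzMap.seminorm ℂ 0 (4 * n) F + SchwartzMap.seminorm ℂ (6 * n) (4 * n) F +
          SchwartzMap.seminorm ℂ 0 0 F + SchwartzMap.seminorm ℂ (6 * n) 0 F +
          SchwartzMap.seminorm ℂ (10 * n) 0 F) := by
  classical
  -- a box of half-side `L ≥ max 14 ⌈a⁻²⌉` containing `T`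
  obtain ⟨L, hL, hTL⟩ := subset_piFinset_box T (max 14 ⌈a⁻¹ * a⁻¹⌉₊)
  have hL14 : 14 ≤ L := le_trans (le_max_left _ _) hL
  have hLa : a⁻¹ * a⁻¹ ≤ L := by
    have h1 : ((⌈a⁻¹ * a⁻¹⌉₊ : ℕ) : ℝ) ≤ L := by exact_mod_cast le_trans (le_max_right _ _) hL
    exact (Nat.le_ceil _).trans h1
  calc ∑ x ∈ T, |W x| * ‖F (y x)‖
      ≤ ∑ x ∈ Fintype.piFinset (fun _ : Fin n => box 4 L), |W x| * ‖F (y x)‖ :=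
        Finset.sum_le_sum_of_subset_of_nonneg hTL fun x _ _ => by positivity
    _ ≤ _ := sum_abs_weight_mul_norm_le hℓ hC hM W hWsup (torusCollar_of_zdCollar H L) ha ha1 haℓ hL14 hLa hn
        hs hs6 hsa F hF y hyx

/-- **Absolute summability on `(ℤ⁴)ⁿ`** of `x ↦ |W x|·‖F(y x)‖` under the hypotheses of
`sum_abs_weight_mul_norm_le_of_zdCollar`. [folklore] -/
theorem summable_abs_weight_mul_norm {C ℓ₄ M a s : ℝ} (hℓ : 0 < ℓ₄) (hC : 0 ≤ C) (hM : 0 ≤ M)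
    (W : (Fin n → Site 4) → ℝ) (hWsup : ∀ x, |W x| ≤ M ^ n)
    (H : ∀ (x : Fin n → Site 4) (R : ℕ), 1 ≤ R → (R : ℝ) * a ≤ ℓ₄ →
      (∀ i j : Fin n, i ≠ j → ∃ k : Fin 4, (2 * (R : ℤ) + 4) ≤ |x i k - x j k|) →
      |W x| ≤ (C / (R : ℝ) ^ 4) ^ n)
    (ha : 0 < a) (ha1 : a ≤ 1) (haℓ : a ≤ ℓ₄) (hn : 2 ≤ n) (hs : 0 ≤ s) (hs6 : s ≤ 6) (hsa : s * a ≤ 1 / 4)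
    (F : 𝓢((Fin n → EuclideanSpace ℝ (Fin 4)), ℂ)) (hF : IsOffDiagonal F)
    (y : (Fin n → Site 4) → (Fin n → EuclideanSpace ℝ (Fin 4)))
    (hyx : ∀ x l, ‖y x l - a • siteToE (x l)‖ ≤ s * a) :
    Summable fun x : Fin n → Site 4 => |W x| * ‖F (y x)‖ :=
  summable_of_sum_le (fun x => by positivity)
    (sum_abs_weight_mul_norm_le_of_zdCollar hℓ hC hM W hWsup H ha ha1 haℓ hn hs hs6 hsa F hF y hyx)

/-- **The series bound**: `Σ'_{x ∈ (ℤ⁴)ⁿ} |W x|·‖F(y x)‖ ≤ Kⁿ·Σ(F)`. [folklore] -/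
theorem tsum_abs_weight_mul_norm_le {C ℓ₄ M a s : ℝ} (hℓ : 0 < ℓ₄) (hC : 0 ≤ C) (hM : 0 ≤ M)
    (W : (Fin n → Site 4) → ℝ) (hWsup : ∀ x, |W x| ≤ M ^ n)
    (H : ∀ (x : Fin n → Site 4) (R : ℕ), 1 ≤ R → (R : ℝ) * a ≤ ℓ₄ →
      (∀ i j : Fin n, i ≠ j → ∃ k : Fin 4, (2 * (R : ℤ) + 4) ≤ |x i k - x j k|) →
      |W x| ≤ (C / (R : ℝ) ^ 4) ^ n)
    (ha : 0 < a) (ha1 : a ≤ 1) (haℓ : a ≤ ℓ₄) (hn : 2 ≤ n) (hs : 0 ≤ s) (hs6 : s ≤ 6) (hsa : s * a ≤ 1 / 4)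
    (F : 𝓢((Fin n → EuclideanSpace ℝ (Fin 4)), ℂ)) (hF : IsOffDiagonal F)
    (y : (Fin n → Site 4) → (Fin n → EuclideanSpace ℝ (Fin 4)))
    (hyx : ∀ x l, ‖y x l - a • siteToE (x l)‖ ≤ s * a) :
    ∑' x : Fin n → Site 4, |W x| * ‖F (y x)‖ ≤
      ((M * 4 ^ 4 * 5 ^ 6 + M * 2 ^ 6 * (10 + 2 * s) ^ 4 + 16 * C * 2 ^ 6 * (2 / ℓ₄ + 48) ^ 4) * 2 ^ 6 *
          (81 * ∑' m : ℕ, (((m : ℝ) + 1) ^ 2)⁻¹)) ^ n *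
        (SchwartzMap.seminorm ℂ 0 (4 * n) F + SchwartzMap.seminorm ℂ (6 * n) (4 * n) F +
          SchwartzMap.seminorm ℂ 0 0 F + SchwartzMap.seminorm ℂ (6 * n) 0 F +
          SchwartzMap.seminorm ℂ (10 * n) 0 F) :=
  Real.tsum_le_of_sum_le (fun x => by positivity)
    (sum_abs_weight_mul_norm_le_of_zdCollar hℓ hC hM W hWsup H ha ha1 haℓ hn hs hs6 hsa F hF y hyx)

/-- **The complex series `Σ'ₓ W(x)·F(y x)` converges absolutely.** [folklore] -/
theorem summable_weight_mul {C ℓ₄ M a s : ℝ} (hℓ : 0 < ℓ₄) (hC : 0 ≤ C) (hM : 0 ≤ M)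
    (W : (Fin n → Site 4) → ℝ) (hWsup : ∀ x, |W x| ≤ M ^ n)
    (H : ∀ (x : Fin n → Site 4) (R : ℕ), 1 ≤ R → (R : ℝ) * a ≤ ℓ₄ →
      (∀ i j : Fin n, i ≠ j → ∃ k : Fin 4, (2 * (R : ℤ) + 4) ≤ |x i k - x j k|) →
      |W x| ≤ (C / (R : ℝ) ^ 4) ^ n)
    (ha : 0 < a) (ha1 : a ≤ 1) (haℓ : a ≤ ℓ₄) (hn : 2 ≤ n) (hs : 0 ≤ s) (hs6 : s ≤ 6) (hsa : s * a ≤ 1 / 4)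
    (F : 𝓢((Fin n → EuclideanSpace ℝ (Fin 4)), ℂ)) (hF : IsOffDiagonal F)
    (y : (Fin n → Site 4) → (Fin n → EuclideanSpace ℝ (Fin 4)))
    (hyx : ∀ x l, ‖y x l - a • siteToE (x l)‖ ≤ s * a) :
    Summable fun x : Fin n → Site 4 => ((W x : ℝ) : ℂ) * F (y x) := by
  refine Summable.of_norm_bounded
    (summable_abs_weight_mul_norm hℓ hC hM W hWsup H ha ha1 haℓ hn hs hs6 hsa F hF y hyx) fun x => ?_
  rw [norm_mul, Complex.norm_real, Real.norm_eq_abs]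

/-- **The a-uniform bound for the series over `(ℤ⁴)ⁿ`**: `‖Σ'ₓ W(x)·F(y x)‖ ≤ Kⁿ·Σ(F) ≤ 5Kⁿ·‖F‖_{10n}`
(`schwartzNorm`). [folklore] -/
theorem norm_tsum_weight_mul_le {C ℓ₄ M a s : ℝ} (hℓ : 0 < ℓ₄) (hC : 0 ≤ C) (hM : 0 ≤ M)
    (W : (Fin n → Site 4) → ℝ) (hWsup : ∀ x, |W x| ≤ M ^ n)
    (H : ∀ (x : Fin n → Site 4) (R : ℕ), 1 ≤ R → (R : ℝ) * a ≤ ℓ₄ →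
      (∀ i j : Fin n, i ≠ j → ∃ k : Fin 4, (2 * (R : ℤ) + 4) ≤ |x i k - x j k|) →
      |W x| ≤ (C / (R : ℝ) ^ 4) ^ n)
    (ha : 0 < a) (ha1 : a ≤ 1) (haℓ : a ≤ ℓ₄) (hn : 2 ≤ n) (hs : 0 ≤ s) (hs6 : s ≤ 6) (hsa : s * a ≤ 1 / 4)
    (F : 𝓢((Fin n → EuclideanSpace ℝ (Fin 4)), ℂ)) (hF : IsOffDiagonal F)
    (y : (Fin n → Site 4) → (Fin n → EuclideanSpace ℝ (Fin 4)))
    (hyx : ∀ x l, ‖y x l - a • siteToE (x l)‖ ≤ s * a) :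
    ‖∑' x : Fin n → Site 4, ((W x : ℝ) : ℂ) * F (y x)‖ ≤
      5 * ((M * 4 ^ 4 * 5 ^ 6 + M * 2 ^ 6 * (10 + 2 * s) ^ 4 + 16 * C * 2 ^ 6 * (2 / ℓ₄ + 48) ^ 4) * 2 ^ 6 *
          (81 * ∑' m : ℕ, (((m : ℝ) + 1) ^ 2)⁻¹)) ^ n * schwartzNorm (10 * n) F := by
  set K : ℝ := (M * 4 ^ 4 * 5 ^ 6 + M * 2 ^ 6 * (10 + 2 * s) ^ 4 + 16 * C * 2 ^ 6 * (2 / ℓ₄ + 48) ^ 4) * 2 ^ 6 *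
    (81 * ∑' m : ℕ, (((m : ℝ) + 1) ^ 2)⁻¹) with hK
  have hK0 : 0 ≤ K := by
    have : 0 ≤ ∑' m : ℕ, (((m : ℝ) + 1) ^ 2)⁻¹ := tsum_nonneg fun m => by positivity
    positivity
  have hsum := summable_abs_weight_mul_norm hℓ hC hM W hWsup H ha ha1 haℓ hn hs hs6 hsa F hF y hyx
  have hnorm : ∀ x : Fin n → Site 4, ‖((W x : ℝ) : ℂ) * F (y x)‖ = |W x| * ‖F (y x)‖ := fun x => by
    rw [norm_mul, Complex.norm_real, Real.norm_eq_abs]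
  calc ‖∑' x : Fin n → Site 4, ((W x : ℝ) : ℂ) * F (y x)‖
      ≤ ∑' x : Fin n → Site 4, ‖((W x : ℝ) : ℂ) * F (y x)‖ := norm_tsum_le_tsum_norm (by simpa [hnorm] using hsum)
    _ = ∑' x : Fin n → Site 4, |W x| * ‖F (y x)‖ := by simp_rw [hnorm]
    _ ≤ K ^ n * (SchwartzMap.seminorm ℂ 0 (4 * n) F + SchwartzMap.seminorm ℂ (6 * n) (4 * n) F +
          SchwartzMap.seminorm ℂ 0 0 F + SchwartzMap.seminorm ℂ (6 * n) 0 F +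
          SchwartzMap.seminorm ℂ (10 * n) 0 F) :=
        tsum_abs_weight_mul_norm_le hℓ hC hM W hWsup H ha ha1 haℓ hn hs hs6 hsa F hF y hyx
    _ ≤ K ^ n * (5 * schwartzNorm (10 * n) F) := by
        gcongr
        exact seminorm_budget_le_schwartzNorm n F
    _ = 5 * K ^ n * schwartzNorm (10 * n) F := by ring

end Abstract

/-! ## §3 The plane-string weights of a state on `ℤ⁴` gauge fields -/

section State

variable {G : Type} [Group G] [TopologicalSpace G] [MeasurableSpace G]

/-- **Sup bound for the centred plane-string weights of a probability measure**: with `|plane| ≤ Cₚ`,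
`|∫ ∏ᵢ (plane qᵢ xᵢ − ∫ plane qᵢ xᵢ dμ) dμ| ≤ (Cₚ + Cₚ)ⁿ`. [folklore] -/
theorem abs_infVolWeight_le (r : LatticeRep G) {Cp : ℝ}
    (hCp : ∀ (q : Fin 4 × Fin 4) (x : Fin 4 → ℤ) (U : LGConfig 4 G), |plane G r q x U| ≤ Cp)
    (μ : Measure (LGConfig 4 G)) [IsProbabilityMeasure μ] {n : ℕ} (q : Fin n → Fin 4 × Fin 4)
    (x : Fin n → Site 4) :
    |∫ U, ∏ i, (plane G r (q i) (x i) U - ∫ V, plane G r (q i) (x i) V ∂μ) ∂μ| ≤ (Cp + Cp) ^ n := by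
  have hmean : ∀ i, |∫ V, plane G r (q i) (x i) V ∂μ| ≤ Cp := fun i => by
    have h := norm_integral_le_of_norm_le_const (μ := μ) (f := plane G r (q i) (x i)) (C := Cp)
      (Eventually.of_forall fun U => by rw [Real.norm_eq_abs]; exact hCp _ _ _)
    simpa [Real.norm_eq_abs] using h
  have hbound : ∀ U : LGConfig 4 G,
      ‖∏ i, (plane G r (q i) (x i) U - ∫ V, plane G r (q i) (x i) V ∂μ)‖ ≤ (Cp + Cp) ^ n := fun U => by
    rw [Real.norm_eq_abs, Finset.abs_prod]
    calc _ ≤ ∏ _i : Fin n, (Cp + Cp) := Finset.prod_le_prod (fun _ _ => abs_nonneg _) fun i _ =>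
          (abs_sub _ _).trans (add_le_add (hCp (q i) (x i) U) (hmean i))
      _ = (Cp + Cp) ^ n := by simp
  have h := norm_integral_le_of_norm_le_const (μ := μ) (Eventually.of_forall hbound)
  simpa [Real.norm_eq_abs] using h

/-- **The a-uniform absolute bound for the plane-string functionals of a state with `ℤ⁴`-collar weights**, on
every finite set of multi-sites: for a probability measure `μ` whose centred plane-string weights obey
`|W_μ(q,x)| ≤ (C/R⁴)ⁿ` at `ℤ⁴`-separated sites (`1 ≤ R`, `R·a ≤ ℓ₄`), `0 < a ≤ min 1 ℓ₄`, `n ≥ 2`, valid `q`,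
`F ∈ ⁰𝒮ₙ`, shifts `≤ 6a ≤ 1/4`: `Σ_{x ∈ T} |W_μ(q,x)|·‖F(y x)‖ ≤ Kⁿ·Σ(F)` with
`K = ((Cₚ+Cₚ)(4⁴5⁶ + 2⁶22⁴) + 16C 2⁶(2/ℓ₄+48)⁴)·2⁶·81 Σ(m+1)⁻²`. [folklore] -/
theorem sum_abs_infVolWeight_mul_norm_le (r : LatticeRep G) {Cp : ℝ}
    (hCp : ∀ (q : Fin 4 × Fin 4) (x : Fin 4 → ℤ) (U : LGConfig 4 G), |plane G r q x U| ≤ Cp)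
    (μ : Measure (LGConfig 4 G)) [IsProbabilityMeasure μ] {C ℓ₄ a : ℝ} (hℓ : 0 < ℓ₄) (hC : 0 ≤ C)
    {n : ℕ} (q : Fin n → Fin 4 × Fin 4)
    (Hμ : ∀ (x : Fin n → Site 4) (R : ℕ), 1 ≤ R → (R : ℝ) * a ≤ ℓ₄ →
      (∀ i j : Fin n, i ≠ j → ∃ k : Fin 4, (2 * (R : ℤ) + 4) ≤ |x i k - x j k|) →
      |∫ U, ∏ i, (plane G r (q i) (x i) U - ∫ V, plane G r (q i) (x i) V ∂μ) ∂μ| ≤ (C / (R : ℝ) ^ 4) ^ n)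
    (ha : 0 < a) (ha1 : a ≤ 1) (haℓ : a ≤ ℓ₄) (ha4 : 6 * a ≤ 1 / 4) (hn : 2 ≤ n)
    (F : 𝓢((Fin n → EuclideanSpace ℝ (Fin 4)), ℂ)) (hF : IsOffDiagonal F)
    (y : (Fin n → Site 4) → (Fin n → EuclideanSpace ℝ (Fin 4)))
    (hyx : ∀ x l, ‖y x l - a • siteToE (x l)‖ ≤ 6 * a) (T : Finset (Fin n → Site 4)) :
    ∑ x ∈ T, |∫ U, ∏ i, (plane G r (q i) (x i) U - ∫ V, plane G r (q i) (x i) V ∂μ) ∂μ| * ‖F (y x)‖ ≤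
      (((Cp + Cp) * 4 ^ 4 * 5 ^ 6 + (Cp + Cp) * 2 ^ 6 * (10 + 2 * 6) ^ 4 + 16 * C * 2 ^ 6 * (2 / ℓ₄ + 48) ^ 4) *
          2 ^ 6 * (81 * ∑' m : ℕ, (((m : ℝ) + 1) ^ 2)⁻¹)) ^ n *
        (SchwartzMap.seminorm ℂ 0 (4 * n) F + SchwartzMap.seminorm ℂ (6 * n) (4 * n) F +
          SchwartzMap.seminorm ℂ 0 0 F + SchwartzMap.seminorm ℂ (6 * n) 0 F +
          SchwartzMap.seminorm ℂ (10 * n) 0 F) := by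
  have hCp0 : 0 ≤ Cp := le_trans (abs_nonneg _) (hCp (0, 1) 0 (fun _ => 1))
  exact sum_abs_weight_mul_norm_le_of_zdCollar hℓ hC (by positivity : 0 ≤ Cp + Cp)
    (fun x => ∫ U, ∏ i, (plane G r (q i) (x i) U - ∫ V, plane G r (q i) (x i) V ∂μ) ∂μ)
    (fun x => abs_infVolWeight_le r hCp μ q x) Hμ ha ha1 haℓ hn (by norm_num) le_rfl ha4 F hF y hyx T

/-- **Series form**: under the same hypotheses the series over `(ℤ⁴)ⁿ` converges absolutely and
`‖Σ'ₓ W_μ(q,x)·F(y x)‖ ≤ 5Kⁿ·‖F‖_{10n}`. [folklore] -/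
theorem norm_tsum_infVolWeight_mul_le (r : LatticeRep G) {Cp : ℝ}
    (hCp : ∀ (q : Fin 4 × Fin 4) (x : Fin 4 → ℤ) (U : LGConfig 4 G), |plane G r q x U| ≤ Cp)
    (μ : Measure (LGConfig 4 G)) [IsProbabilityMeasure μ] {C ℓ₄ a : ℝ} (hℓ : 0 < ℓ₄) (hC : 0 ≤ C)
    {n : ℕ} (q : Fin n → Fin 4 × Fin 4)
    (Hμ : ∀ (x : Fin n → Site 4) (R : ℕ), 1 ≤ R → (R : ℝ) * a ≤ ℓ₄ →
      (∀ i j : Fin n, i ≠ j → ∃ k : Fin 4, (2 * (R : ℤ) + 4) ≤ |x i k - x j k|) →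
      |∫ U, ∏ i, (plane G r (q i) (x i) U - ∫ V, plane G r (q i) (x i) V ∂μ) ∂μ| ≤ (C / (R : ℝ) ^ 4) ^ n)
    (ha : 0 < a) (ha1 : a ≤ 1) (haℓ : a ≤ ℓ₄) (ha4 : 6 * a ≤ 1 / 4) (hn : 2 ≤ n)
    (F : 𝓢((Fin n → EuclideanSpace ℝ (Fin 4)), ℂ)) (hF : IsOffDiagonal F)
    (y : (Fin n → Site 4) → (Fin n → EuclideanSpace ℝ (Fin 4)))
    (hyx : ∀ x l, ‖y x l - a • siteToE (x l)‖ ≤ 6 * a) :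
    (Summable fun x : Fin n → Site 4 =>
        (((∫ U, ∏ i, (plane G r (q i) (x i) U - ∫ V, plane G r (q i) (x i) V ∂μ) ∂μ : ℝ) : ℂ)) * F (y x)) ∧
      ‖∑' x : Fin n → Site 4,
          (((∫ U, ∏ i, (plane G r (q i) (x i) U - ∫ V, plane G r (q i) (x i) V ∂μ) ∂μ : ℝ) : ℂ)) * F (y x)‖ ≤
        5 * (((Cp + Cp) * 4 ^ 4 * 5 ^ 6 + (Cp + Cp) * 2 ^ 6 * (10 + 2 * 6) ^ 4 +
              16 * C * 2 ^ 6 * (2 / ℓ₄ + 48) ^ 4) * 2 ^ 6 * (81 * ∑' m : ℕ, (((m : ℝ) + 1) ^ 2)⁻¹)) ^ n *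
          schwartzNorm (10 * n) F := by
  have hCp0 : 0 ≤ Cp := le_trans (abs_nonneg _) (hCp (0, 1) 0 (fun _ => 1))
  exact ⟨summable_weight_mul hℓ hC (by positivity : 0 ≤ Cp + Cp)
      (fun x => ∫ U, ∏ i, (plane G r (q i) (x i) U - ∫ V, plane G r (q i) (x i) V ∂μ) ∂μ)
      (fun x => abs_infVolWeight_le r hCp μ q x) Hμ ha ha1 haℓ hn (by norm_num) le_rfl ha4 F hF y hyx,
    norm_tsum_weight_mul_le hℓ hC (by positivity : 0 ≤ Cp + Cp)
      (fun x => ∫ U, ∏ i, (plane G r (q i) (x i) U - ∫ V, plane G r (q i) (x i) V ∂μ) ∂μ)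
      (fun x => abs_infVolWeight_le r hCp μ q x) Hμ ha ha1 haℓ hn (by norm_num) le_rfl ha4 F hF y hyx⟩

end State

/-! ## §4 From `MomentBounds6`: the a-uniform E0′ bound for EVERY odd-torus limit state -/

section OddTorus

variable {G : Type} [Group G] [TopologicalSpace G] [IsTopologicalGroup G] [CompactSpace G]
  [MeasurableSpace G] [BorelSpace G]

/-- **THE a-UNIFORM E0′ BOUND IN INFINITE VOLUME.**  From `MomentBounds6 G r a`: `β₄`, `ℓ₄ > 0` and ONE `K ≥ 0`
such that for every `β ≥ β₄` with `0 < a β ≤ 1/24`, `a β ≤ ℓ₄`, EVERY `μ ∈ oddTorusLimitPoints r β`, every `n ≥ 2`,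
valid plane string `q`, `F ∈ ⁰𝒮ₙ`, evaluation points `‖(y x)_l − aβ·x_l‖ ≤ 6·aβ` and EVERY finite `T ⊆ (ℤ⁴)ⁿ`:
`Σ_{x ∈ T} |∫ ∏ᵢ (plane qᵢ xᵢ − ∫ plane qᵢ xᵢ dμ) dμ|·‖F (y x)‖ ≤ Kⁿ·(S₀,₄ₙ + S₆ₙ,₄ₙ + S₀,₀ + S₆ₙ,₀ + S₁₀ₙ,₀)(F)` — the
infinite-volume twin of the spine's `norm_latticeSumStr_plane_le` (step 1 + §3). [folklore] -/
theorem exists_uniformBound_oddTorusLimitPoints (r : LatticeRep G) {a : ℝ → ℝ} (hMB : MomentBounds6 G r a) :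
    ∃ (β₄ ℓ₄ K : ℝ), 0 < ℓ₄ ∧ 0 ≤ K ∧ ∀ β : ℝ, β₄ ≤ β → 0 < a β → a β ≤ 1 / 24 → a β ≤ ℓ₄ →
      ∀ μ ∈ oddTorusLimitPoints r β,
      ∀ n : ℕ, 2 ≤ n → ∀ q : Fin n → Fin 4 × Fin 4, (∀ i, (q i).1 < (q i).2) →
      ∀ F : 𝓢((Fin n → EuclideanSpace ℝ (Fin 4)), ℂ), IsOffDiagonal F →
      ∀ y : (Fin n → Site 4) → (Fin n → EuclideanSpace ℝ (Fin 4)),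
        (∀ x l, ‖y x l - a β • siteToE (x l)‖ ≤ 6 * a β) →
      ∀ T : Finset (Fin n → Site 4),
        ∑ x ∈ T, |∫ U, ∏ i, (plane G r (q i) (x i) U - ∫ V, plane G r (q i) (x i) V ∂μ) ∂μ| * ‖F (y x)‖ ≤
          K ^ n * (SchwartzMap.seminorm ℂ 0 (4 * n) F + SchwartzMap.seminorm ℂ (6 * n) (4 * n) F +
            SchwartzMap.seminorm ℂ 0 0 F + SchwartzMap.seminorm ℂ (6 * n) 0 F +
            SchwartzMap.seminorm ℂ (10 * n) 0 F) := by
  obtain ⟨C, β₄, ℓ₄, hℓ, hC, H⟩ := hMB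
  obtain ⟨Cp, hCp⟩ := exists_abs_plane_le (G := G) r
  have hCp0 : 0 ≤ Cp := le_trans (abs_nonneg _) (hCp (0, 1) 0 (fun _ => 1))
  refine ⟨β₄, ℓ₄, ((Cp + Cp) * 4 ^ 4 * 5 ^ 6 + (Cp + Cp) * 2 ^ 6 * (10 + 2 * 6) ^ 4 +
      16 * C * 2 ^ 6 * (2 / ℓ₄ + 48) ^ 4) * 2 ^ 6 * (81 * ∑' m : ℕ, (((m : ℝ) + 1) ^ 2)⁻¹), hℓ, ?_, ?_⟩
  · have : 0 ≤ ∑' m : ℕ, (((m : ℝ) + 1) ^ 2)⁻¹ := tsum_nonneg fun m => by positivity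
    positivity
  intro β hβ ha ha24 haℓ μ hμ n hn q hq F hF y hyx T
  haveI : IsProbabilityMeasure μ := by
    obtain ⟨S, -, hlim⟩ := hμ
    exact hlim.1
  have ha1 : a β ≤ 1 := ha24.trans (by norm_num)
  have ha4 : 6 * a β ≤ 1 / 4 := by linarith
  exact sum_abs_infVolWeight_mul_norm_le r hCp μ hℓ hC q
    (fun x R hR hRa hsep => momentBounds6_oddTorusLimitPoints r H hβ hμ q x R hq hR hRa hsep)
    ha ha1 haℓ ha4 hn F hF y hyx T

/-- **Series form for odd-torus limit states**: the plane-string series over `(ℤ⁴)ⁿ` converges absolutely and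
`‖Σ'ₓ W_μ(q,x)·F(y x)‖ ≤ 5Kⁿ·‖F‖_{10n}` (same `K`). [folklore] -/
theorem exists_tsumBound_oddTorusLimitPoints (r : LatticeRep G) {a : ℝ → ℝ} (hMB : MomentBounds6 G r a) :
    ∃ (β₄ ℓ₄ K : ℝ), 0 < ℓ₄ ∧ 0 ≤ K ∧ ∀ β : ℝ, β₄ ≤ β → 0 < a β → a β ≤ 1 / 24 → a β ≤ ℓ₄ →
      ∀ μ ∈ oddTorusLimitPoints r β,
      ∀ n : ℕ, 2 ≤ n → ∀ q : Fin n → Fin 4 × Fin 4, (∀ i, (q i).1 < (q i).2) →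
      ∀ F : 𝓢((Fin n → EuclideanSpace ℝ (Fin 4)), ℂ), IsOffDiagonal F →
      ∀ y : (Fin n → Site 4) → (Fin n → EuclideanSpace ℝ (Fin 4)),
        (∀ x l, ‖y x l - a β • siteToE (x l)‖ ≤ 6 * a β) →
        (Summable fun x : Fin n → Site 4 =>
            (((∫ U, ∏ i, (plane G r (q i) (x i) U - ∫ V, plane G r (q i) (x i) V ∂μ) ∂μ : ℝ) : ℂ)) * F (y x)) ∧
        ‖∑' x : Fin n → Site 4,
            (((∫ U, ∏ i, (plane G r (q i) (x i) U - ∫ V, plane G r (q i) (x i) V ∂μ) ∂μ : ℝ) : ℂ)) * F (y x)‖ ≤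
          5 * K ^ n * schwartzNorm (10 * n) F := by
  obtain ⟨C, β₄, ℓ₄, hℓ, hC, H⟩ := hMB
  obtain ⟨Cp, hCp⟩ := exists_abs_plane_le (G := G) r
  have hCp0 : 0 ≤ Cp := le_trans (abs_nonneg _) (hCp (0, 1) 0 (fun _ => 1))
  refine ⟨β₄, ℓ₄, ((Cp + Cp) * 4 ^ 4 * 5 ^ 6 + (Cp + Cp) * 2 ^ 6 * (10 + 2 * 6) ^ 4 +
      16 * C * 2 ^ 6 * (2 / ℓ₄ + 48) ^ 4) * 2 ^ 6 * (81 * ∑' m : ℕ, (((m : ℝ) + 1) ^ 2)⁻¹), hℓ, ?_, ?_⟩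
  · have : 0 ≤ ∑' m : ℕ, (((m : ℝ) + 1) ^ 2)⁻¹ := tsum_nonneg fun m => by positivity
    positivity
  intro β hβ ha ha24 haℓ μ hμ n hn q hq F hF y hyx
  haveI : IsProbabilityMeasure μ := by
    obtain ⟨S, -, hlim⟩ := hμ
    exact hlim.1
  have ha1 : a β ≤ 1 := ha24.trans (by norm_num)
  have ha4 : 6 * a β ≤ 1 / 4 := by linarith
  exact norm_tsum_infVolWeight_mul_le r hCp μ hℓ hC q
    (fun x R hR hRa hsep => momentBounds6_oddTorusLimitPoints r H hβ hμ q x R hq hR hRa hsep)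
    ha ha1 haℓ ha4 hn F hF y hyx

end OddTorus

end Summit.QuantumFields.YangMills.Theorems.InfiniteVolume

end
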